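import Summits.KontsevichZagierPeriods.KontsevichZagierPeriods.Theorems.LinRedNormalFormArrangementNormalFormStubRebaseSimpleZeroNestedSuper

/-!
# Stub `stub_rebaseSimpleZeroTwo`, part `rebaseSimpleZero_nestedCommon` (crux `ArrangementNormalForm`,
line `janus-bands`) — brick `NestedPinchU`

A clean nested pair `A(y) < tᵢ < tⱼ < B(y)` (constant letters, simple base pole) over a short
base cell `{0 < ε₁ (y − y₀) < ε}` at a PINCH END `y₀` whose bounds pass through the vertex
`(y₀, t₀)` and OPEN UPWARDS (`0 < ε₁ A' ≤ ε₁ B'`) is good for `GG 0 2 2` in each of the three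
sub-cases:
* `IsNest.good_pinch_free` — no fibre letter equals `t₀`: `RebaseNest.pinchAbove` (sub-section
  Janus at `t₀`, cone estimate);
* `IsNest.good_pinch_super` — fibre letters at `t₀` allowed, base pole AWAY from `y₀`:
  super-section Janus `IsNest.good_super`, the nest `{A < tᵢ < tⱼ < T}` converging by the
  log-cone estimate (`RebaseNest.abs_glit_le_super`, `RebaseNest.integrableOn_logCone`);
* `IsNest.good_pinch_blow` — a fibre letter at `t₀` and the base pole AT `y₀`: this is the
  pinch-vertex BLOW-UP move of worker W4, taken as the explicit hypothesis `RebaseNest.BlowUp`.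
Registered: `rebaseSimpleZero_nestedPinchSuper`.

References: M. Kontsevich, D. Zagier, *Periods* (2001), §1.2, rules (1a), (2).
-/

noncomputable section

open Set MeasureTheory MvPolynomial
open Literature.NumberTheory.Transcendental Literature.ModelTheory.ExponentialFields

namespace Summit.KontsevichZagierPeriods.ArrangementNormalForm.JanusBands

namespace RebaseNest

open SeparatePos RebasePos RebaseZero

/-- **The pinch-vertex blow-up hypothesis** (worker W4's move `rebaseSimpleZero_nestedBlowUp`):
a clean nest `A < tᵢ < tⱼ < B` over the two-row cell `{0 < ε₁ (y − y₀) < ε}` whose bounds pass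
through the vertex `(y₀, t₀)` and open upwards (`0 < ε₁ A' < ε₁ B'`), with simple base pole AT
`y₀`, constant letters all equal to `t₀` except on at most one fibre, is good for `GG 0 2 2`.
[Kontsevich–Zagier 2001, §1.2, rule (2)] -/
def BlowUp : Prop :=
  ∀ (m : ℕ) (s : KZ.IntegralRep (0 + 1 + 2)) (L : Fin m → (Fin 0 → ℚ) × ℚ) (e : Fin m → ℕ)
    (p : MvPolynomial (Fin 0) ℚ) (ℓ₁ ℓ₂ : (Fin 0 → ℚ) × ℚ) (n₁ n₂ : ℕ)
    (a : Fin 2 → Option ((Fin (0 + 1) → ℚ) × ℚ)) (lo hi : Fin 2 → Fin 2 ⊕ ((Fin (0 + 1) → ℚ) × ℚ))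
    (i j : Fin 2) (A Bd : (Fin (0 + 1) → ℚ) × ℚ) (y₀ t₀ ε ε₁ : ℚ),
    i ≠ j → lo i = Sum.inr A → hi i = Sum.inl j → lo j = Sum.inl i → hi j = Sum.inr Bd →
    n₁ = 0 → n₂ = 1 → 0 < ε → (ε₁ = 1 ∨ ε₁ = -1) → ℓ₂.2 = y₀ →
    A.1 (Fin.last 0) * y₀ + A.2 = t₀ → Bd.1 (Fin.last 0) * y₀ + Bd.2 = t₀ →
    0 < ε₁ * A.1 (Fin.last 0) → ε₁ * A.1 (Fin.last 0) < ε₁ * Bd.1 (Fin.last 0) →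
    (∀ l c, a l = some c → c.1 (Fin.last 0) = 0) →
    (∃ l₀ : Fin 2, ∀ l c, l ≠ l₀ → a l = some c → c.2 = t₀) →
    Bornology.IsBounded s.domain →
    s.domain = SeparatePos.gDom 0 2 2
      ![RebaseZero.mk ε₁ (-(ε₁ * y₀)), RebaseZero.mk (-ε₁) (ε₁ * y₀ + ε)] lo hi →
    EqOn s.integrand (RebasePos.glit 0 2 p L e ℓ₁ ℓ₂ n₁ n₂ a) s.domain →
    ∃ c ∈ AddSubgroup.closure (SeparatePos.GGset 0 2 2), KZ.of s - c ∈ KZ.relations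

/-! ### The vertex normal form of the bounds -/

/-- On the side `0 < ε₁ (y − y₀)` (`ε₁ = ±1`), a bound through the vertex `(y₀, t₀)` reads
`A(y) = t₀ + (ε₁ A') |y − y₀|`, and `|y − y₀| = ε₁ (y − y₀)`. [folklore] -/
theorem ev_vertex {A : Cf} {y₀ t₀ ε₁ : ℚ} (hε₁ : ε₁ = 1 ∨ ε₁ = -1)
    (hA0 : A.1 (Fin.last 0) * y₀ + A.2 = t₀) {y : ℝ} (hy : 0 < (ε₁ : ℝ) * (y - y₀)) :
    ev A y = t₀ + ε₁ * A.1 (Fin.last 0) * |y - y₀| ∧ |y - y₀| = ε₁ * (y - y₀) := by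
  have hε2 : (ε₁ : ℝ) * ε₁ = 1 := by rcases hε₁ with rfl | rfl <;> norm_num
  have habs : |y - y₀| = ε₁ * (y - y₀) := by
    rcases hε₁ with rfl | rfl
    · push_cast at hy ⊢
      rw [one_mul] at hy ⊢
      exact abs_of_pos hy
    · push_cast at hy ⊢
      rw [neg_one_mul] at hy ⊢
      exact abs_of_neg (by linarith)
  refine ⟨?_, habs⟩
  have h2 : (A.1 (Fin.last 0) : ℝ) * y₀ + A.2 = t₀ := by
    have h := congrArg (fun q : ℚ => (q : ℝ)) hA0
    simp only [Rat.cast_add, Rat.cast_mul] at h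
    exact h
  rw [habs, ev]
  linear_combination h2 + (-(A.1 (Fin.last 0) : ℝ) * (y - y₀)) * hε2

/-- A constant letter evaluates to its intercept. [folklore] -/
theorem ev_of_fst_eq_zero {c : Cf} (hc : c.1 (Fin.last 0) = 0) (y : ℝ) : ev c y = c.2 := by
  rw [ev, hc, Rat.cast_zero, zero_mul, zero_add]

variable {m' : ℕ} {s : KZ.IntegralRep (0 + 1 + 2)} {M : Fin m' → Cf} {i j : Fin 2} {A Bd : Cf} {T : BData}
  {p : MvPolynomial (Fin 0) ℚ} {a : Fin 2 → Option Cf}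

/-! ### U1: no fibre pole at the vertex level -/

/-- **Pinch above, no fibre letter at `t₀`**: `RebaseNest.pinchAbove` in the language of
`IsNest`, for a cell inside `{0 < ε₁ (y − y₀) < ε}` on which the base pole is not closer than
`y₀` and the letters keep the distance `η` from `(t₀, B)`. -/
theorem IsNest.good_pinch_free (hN : IsNest s M i j A Bd T p a) (y₀ t₀ ε₁ ε η : ℚ)
    (hε₁ : ε₁ = 1 ∨ ε₁ = -1) (hA0 : A.1 (Fin.last 0) * y₀ + A.2 = t₀)
    (hB0 : Bd.1 (Fin.last 0) * y₀ + Bd.2 = t₀) (hα : 0 < ε₁ * A.1 (Fin.last 0))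
    (hαβ : ε₁ * A.1 (Fin.last 0) ≤ ε₁ * Bd.1 (Fin.last 0))
    (hcell : ∀ y ∈ cell M, 0 < (ε₁ : ℝ) * (y - y₀) ∧ (ε₁ : ℝ) * (y - y₀) < ε)
    (hpole : ∀ y ∈ cell M, |y - (y₀ : ℝ)| ≤ |y - T.ℓ₂.2|) (hη : 0 < η)
    (hfar : ∀ l c, a l = some c → ∀ y ∈ cell M, ∀ t : ℝ, (t₀ : ℝ) < t → t < ev Bd y → (η : ℝ) ≤ |t - c.2|) :
    Good 2 (KZ.of s) := by
  have hβ : 0 < ε₁ * Bd.1 (Fin.last 0) := hα.trans_le hαβ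
  have hα' : (0 : ℝ) < ε₁ * A.1 (Fin.last 0) := by exact_mod_cast hα
  have hαβ' : (ε₁ : ℝ) * A.1 (Fin.last 0) ≤ ε₁ * Bd.1 (Fin.last 0) := by exact_mod_cast hαβ
  have key : ∀ z : Fin (0 + 1 + 2) → ℝ, (∀ r, 0 < affF 0 2 (M r) z) → yv z ∈ cell M ∧
      affF 0 2 A z = t₀ + ε₁ * A.1 (Fin.last 0) * |yv z - y₀| ∧
      affF 0 2 Bd z = t₀ + ε₁ * Bd.1 (Fin.last 0) * |yv z - y₀| ∧
      0 < |yv z - y₀| ∧ |yv z - y₀| < ε := fun z hz => by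
    have hy := (rows_iff M z).1 hz
    obtain ⟨h1, h2⟩ := hcell _ hy
    obtain ⟨eA, habs⟩ := ev_vertex hε₁ hA0 h1
    obtain ⟨eB, -⟩ := ev_vertex hε₁ hB0 h1
    rw [affF_eq, affF_eq, eA, eB, habs]
    exact ⟨hy, rfl, rfl, h1, h2⟩
  refine pinchAbove s M T.L T.e p T.ℓ₁ T.ℓ₂ a (nlo i A) (nhi j Bd) hN.n1 hN.n2 hN.dom hN.int hN.ne A Bd
    (nlo_self i A) (nhi_of_ne hN.ne Bd) (nlo_of_ne hN.ne A) (nhi_self j Bd) hN.a0 y₀ t₀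
    (ε₁ * Bd.1 (Fin.last 0)) η ε hβ hη (fun z hz => ?_) (fun z hz => ?_) (fun z hz => ?_)
    (fun z hz => ?_) (fun z hz => ?_) (fun l c hc z hz t ht1 ht2 => ?_)
  · obtain ⟨-, -, -, h0, hε⟩ := key z hz
    exact ⟨h0, hε.le⟩
  · exact hpole _ (key z hz).1
  · obtain ⟨-, eA, -, h0, -⟩ := key z hz
    rw [eA]
    nlinarith
  · obtain ⟨-, eA, eB, h0, -⟩ := key z hz
    rw [eA, eB]
    nlinarith
  · obtain ⟨-, -, eB, -, -⟩ := key z hz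
    rw [eB, Rat.cast_mul]
    exact le_rfl
  · have hc2 : affF 0 2 c z = c.2 := by rw [affF_eq, ev_of_fst_eq_zero (hN.a0 l c hc)]
    rw [hc2]
    rw [affF_eq] at ht2
    exact hfar l c hc _ (key z hz).1 t ht1 ht2

/-! ### U2: fibre poles at the vertex level, base pole away -/

/-- The literal integrand on `{t₀ < tₗ < T}` with constant letters at `t₀` or `η`-far from
`(t₀, T)` and base pole `d`-far is `O(1/((t₁ − t₀)(t₂ − t₀)))`. [folklore] -/
theorem abs_glit_le_super {m : ℕ} (L : Fin m → (Fin 0 → ℚ) × ℚ) (e : Fin m → ℕ) (p : MvPolynomial (Fin 0) ℚ)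
    (ℓ₁ ℓ₂ : (Fin 0 → ℚ) × ℚ) (a : Fin 2 → Option Cf) {n₁ n₂ : ℕ} (h1 : n₁ = 0) (hn : n₂ = 1)
    (ha0 : ∀ l c, a l = some c → c.1 (Fin.last 0) = 0) (t₀ Tc η d : ℚ) (hη : 0 < η) (hd : 0 < d)
    (hfar : ∀ l c, a l = some c → c.2 ≠ t₀ → ∀ t : ℝ, (t₀ : ℝ) < t → t < Tc → (η : ℝ) ≤ |t - c.2|)
    (z : Fin (0 + 1 + 2) → ℝ) (hz : (d : ℝ) ≤ |yv z - ℓ₂.2|)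
    (ht : ∀ l : Fin 2, (t₀ : ℝ) < tv z l ∧ tv z l < Tc) :
    |glit 0 2 p L e ℓ₁ ℓ₂ n₁ n₂ a z| ≤
      |((p.coeff 0 : ℚ) : ℝ) / ∏ j', ((L j').2 : ℝ) ^ e j'| / d * (((Tc : ℝ) - t₀) + ((Tc : ℝ) - t₀) / η + 1) ^ 2 /
        ((tv z 0 - t₀) * (tv z 1 - t₀)) := by
  subst h1 hn
  set S : ℝ := (Tc : ℝ) - t₀ with hS
  set k : ℝ := S + S / η + 1 with hk
  have hη' : (0 : ℝ) < η := by exact_mod_cast hη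
  have hd' : (0 : ℝ) < d := by exact_mod_cast hd
  have hS0 : 0 < S := by have := ht 0; rw [hS]; linarith [this.1, this.2]
  have hSη : 0 ≤ S / η := by positivity
  have hk1 : 1 ≤ k := by rw [hk]; linarith
  have hSk : S ≤ k := by rw [hk]; linarith
  have hk0 : 0 ≤ k := by linarith
  have hu : ∀ l, 0 < tv z l - t₀ := fun l => sub_pos.2 (ht l).1
  -- per-fibre bound
  have hfac : ∀ l : Fin 2, |(a l).elim (1 : ℝ) (fun c => 1 / (z (Fin.natAdd (0 + 1) l) -
      (∑ i', (c.1 i' : ℝ) * z (Fin.castAdd 2 i') + (c.2 : ℝ))))| ≤ k / (tv z l - t₀) := by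
    intro l
    have hul : tv z l - t₀ < S := by rw [hS]; linarith [(ht l).2]
    rcases h : a l with _ | c
    · simp only [Option.elim_none, abs_one]
      rw [le_div_iff₀ (hu l), one_mul]
      linarith
    · simp only [Option.elim_some]
      rw [sum_eq, ev_of_fst_eq_zero (ha0 l c h), abs_div, abs_one]
      change 1 / |tv z l - c.2| ≤ k / (tv z l - t₀)
      by_cases hc : c.2 = t₀
      · rw [hc, abs_of_pos (hu l)]
        exact div_le_div_of_nonneg_right hk1 (hu l).le
      · have hfl := hfar l c h hc (tv z l) (ht l).1 (ht l).2
        calc 1 / |tv z l - c.2| ≤ 1 / (η : ℝ) := one_div_le_one_div_of_le hη' hfl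
          _ ≤ k / (tv z l - t₀) := by
              rw [div_le_div_iff₀ hη' (hu l), one_mul, hk]
              have : 0 ≤ S * η := by positivity
              have e1 : (S + S / η + 1) * η = S * η + S + η := by field_simp
              rw [e1]
              linarith
  have hfib : |fib 0 2 a z| ≤ k ^ 2 / ((tv z 0 - t₀) * (tv z 1 - t₀)) := by
    rw [fib, Finset.abs_prod, Fin.prod_univ_two]
    calc _ ≤ k / (tv z 0 - t₀) * (k / (tv z 1 - t₀)) :=
          mul_le_mul (hfac 0) (hfac 1) (abs_nonneg _) (div_nonneg hk0 (hu 0).le)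
      _ = _ := by rw [div_mul_div_comm, sq]
  have hp : MvPolynomial.aeval (fun i : Fin 0 => z (Fin.castAdd 2 (Fin.castSucc i))) p = ((p.coeff 0 : ℚ) : ℝ) := by
    conv_lhs => rw [MvPolynomial.eq_C_of_isEmpty p]
    rw [MvPolynomial.aeval_C, eq_ratCast]
  rw [glit_eq, hp, pow_zero, pow_one]
  simp only [affB_zero, abs_mul, abs_div, abs_one]
  change |((p.coeff 0 : ℚ) : ℝ)| / |∏ j', ((L j').2 : ℝ) ^ e j'| * (1 / |yv z - (ℓ₂.2 : ℝ)|) * |fib 0 2 a z| ≤ _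
  have hK : 0 ≤ |((p.coeff 0 : ℚ) : ℝ)| / |∏ j', ((L j').2 : ℝ) ^ e j'| := by positivity
  have hyr : 1 / |yv z - (ℓ₂.2 : ℝ)| ≤ 1 / d := one_div_le_one_div_of_le hd' hz
  have huu : 0 < (tv z 0 - t₀) * (tv z 1 - t₀) := mul_pos (hu 0) (hu 1)
  calc |((p.coeff 0 : ℚ) : ℝ)| / |∏ j', ((L j').2 : ℝ) ^ e j'| * (1 / |yv z - (ℓ₂.2 : ℝ)|) * |fib 0 2 a z|
      ≤ |((p.coeff 0 : ℚ) : ℝ)| / |∏ j', ((L j').2 : ℝ) ^ e j'| * (1 / d) *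
        (k ^ 2 / ((tv z 0 - t₀) * (tv z 1 - t₀))) :=
        mul_le_mul (mul_le_mul_of_nonneg_left hyr hK) hfib (abs_nonneg _) (by positivity)
    _ = _ := by rw [hk, hS]; ring

/-- **Pinch above with fibre letters at `t₀`, base pole away from `y₀`**: super-section Janus at
a constant level `T ≥ t₀ + ε₁ B' ε`, the nest `{A < tᵢ < tⱼ < T}` converging by the log-cone
estimate. -/
theorem IsNest.good_pinch_super (hN : IsNest s M i j A Bd T p a) (y₀ t₀ ε₁ ε Tc η d : ℚ)
    (hε₁ : ε₁ = 1 ∨ ε₁ = -1) (hA0 : A.1 (Fin.last 0) * y₀ + A.2 = t₀)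
    (hB0 : Bd.1 (Fin.last 0) * y₀ + Bd.2 = t₀) (hα : 0 < ε₁ * A.1 (Fin.last 0))
    (hαβ : ε₁ * A.1 (Fin.last 0) ≤ ε₁ * Bd.1 (Fin.last 0))
    (hcell : ∀ y ∈ cell M, 0 < (ε₁ : ℝ) * (y - y₀) ∧ (ε₁ : ℝ) * (y - y₀) < ε)
    (hTc : t₀ + ε₁ * Bd.1 (Fin.last 0) * ε ≤ Tc) (hη : 0 < η)
    (hfar : ∀ l c, a l = some c → c.2 ≠ t₀ → ∀ t : ℝ, (t₀ : ℝ) < t → t < Tc → (η : ℝ) ≤ |t - c.2|)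
    (hd : 0 < d) (hpole : ∀ y ∈ cell M, (d : ℝ) ≤ |y - T.ℓ₂.2|) : Good 2 (KZ.of s) := by
  have hij := hN.ne
  have hα' : (0 : ℝ) < ε₁ * A.1 (Fin.last 0) := by exact_mod_cast hα
  have hαβ' : (ε₁ : ℝ) * A.1 (Fin.last 0) ≤ ε₁ * Bd.1 (Fin.last 0) := by exact_mod_cast hαβ
  have hβ0 : (0 : ℝ) ≤ ε₁ * Bd.1 (Fin.last 0) := hα'.le.trans hαβ'
  have hTc' : (t₀ : ℝ) + ε₁ * Bd.1 (Fin.last 0) * ε ≤ Tc := by exact_mod_cast hTc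
  have hT : ∀ y : ℝ, ev (RebaseZero.mk 0 Tc) y = Tc := fun y => by rw [ev_mk, Rat.cast_zero, zero_mul, zero_add]
  have key : ∀ y ∈ cell M, ev A y = t₀ + ε₁ * A.1 (Fin.last 0) * |y - y₀| ∧
      ev Bd y = t₀ + ε₁ * Bd.1 (Fin.last 0) * |y - y₀| ∧ 0 < |y - y₀| ∧ |y - y₀| < ε := fun y hy => by
    obtain ⟨h1, h2⟩ := hcell _ hy
    obtain ⟨eA, habs⟩ := ev_vertex hε₁ hA0 h1
    obtain ⟨eB, -⟩ := ev_vertex hε₁ hB0 h1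
    rw [eA, eB, habs]
    exact ⟨rfl, rfl, h1, h2⟩
  -- the cell is bounded
  have hR : ∀ y ∈ cell M, |y| ≤ |(y₀ : ℝ)| + ε := fun y hy => by
    have := abs_add_le (y - y₀) y₀
    rw [sub_add_cancel] at this
    linarith [(key y hy).2.2.2]
  refine hN.good_super (t₀ + ε₁ * Bd.1 (Fin.last 0) * ε) Tc (fun y hy => ?_) ?_
    (isBounded_nDom M hR hij A (RebaseZero.mk 0 Tc))
  · obtain ⟨eA, eB, h0, hε⟩ := key y hy
    rw [eA, eB]
    simp only [Rat.cast_add, Rat.cast_mul]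
    exact ⟨by nlinarith, by nlinarith, hTc'⟩
  -- the log-cone estimate on `{A < tᵢ < tⱼ < T}`
  have hWm : MeasurableSet (gDom 0 2 m' M (nlo i A) (nhi j (RebaseZero.mk 0 Tc))) :=
    IsSemialgebraic.measurableSet_holds (isSemialgebraic_gDom _ _ _ _)
  refine integrableOn_logCone (y₀ := y₀) (t₀ := t₀) (α := ε₁ * A.1 (Fin.last 0)) (R := ε) (S := Tc - t₀)
    (K := |((p.coeff 0 : ℚ) : ℝ) / ∏ j', ((T.L j').2 : ℝ) ^ T.e j'| / d *
      (((Tc : ℝ) - t₀) + ((Tc : ℝ) - t₀) / η + 1) ^ 2) hWm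
    (KZ.aestronglyMeasurable_of_isSemialgebraicFunOn
      (isSemialgebraicFunOn_glit (isSemialgebraic_gDom _ _ _ _) _ _ _ _ _ _ _ _) hWm)
    hα' (fun z hz => ?_) (fun z hz => ?_)
  · obtain ⟨hy, h1, h2, h3⟩ := (mem_nDom hij M A (RebaseZero.mk 0 Tc) z).1 hz
    rw [hT] at h3
    obtain ⟨eA, -, h0, hε⟩ := key _ hy
    rw [eA] at h1
    have hl : ∀ l, (ε₁ : ℝ) * A.1 (Fin.last 0) * |yv (k := 2) z - y₀| < tv (k := 2) z l - t₀ ∧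
        tv (k := 2) z l - t₀ < Tc - t₀ :=
      (forall_fin_two_iff hij).2 ⟨⟨by linarith, by linarith⟩, ⟨by linarith, by linarith⟩⟩
    exact ⟨⟨h0, hε.le⟩, hl 0, hl 1⟩
  · obtain ⟨hy, h1, h2, h3⟩ := (mem_nDom hij M A (RebaseZero.mk 0 Tc) z).1 hz
    rw [hT] at h3
    obtain ⟨eA, -, h0, -⟩ := key _ hy
    rw [eA] at h1
    have hpos : 0 < (ε₁ : ℝ) * A.1 (Fin.last 0) * |yv (k := 2) z - y₀| := mul_pos hα' h0
    have hl : ∀ l, (t₀ : ℝ) < tv (k := 2) z l ∧ tv (k := 2) z l < Tc :=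
      (forall_fin_two_iff hij).2 ⟨⟨by linarith, by linarith⟩, ⟨by linarith, by linarith⟩⟩
    exact abs_glit_le_super T.L T.e p T.ℓ₁ T.ℓ₂ a hN.n1 hN.n2 hN.a0 t₀ Tc η d hη hd hfar z (hpole _ hy) hl

/-! ### U3: a fibre pole at the vertex, base pole at `y₀` (the blow-up hypothesis) -/

/-- The base cell of the two explicit rows `{0 < ε₁ (y − y₀)}`, `{ε₁ (y − y₀) < ε}`. [folklore] -/
theorem mem_cell_two (y₀ ε ε₁ : ℚ) (y : ℝ) :
    y ∈ cell ![RebaseZero.mk ε₁ (-(ε₁ * y₀)), RebaseZero.mk (-ε₁) (ε₁ * y₀ + ε)] ↔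
      0 < (ε₁ : ℝ) * (y - y₀) ∧ (ε₁ : ℝ) * (y - y₀) < ε := by
  simp only [cell, mem_setOf_eq, Fin.forall_fin_two, Matrix.cons_val_zero, Matrix.cons_val_one, ev_mk]
  push_cast
  constructor <;> rintro ⟨h1, h2⟩ <;> constructor <;> linarith

/-- **Pinch above with a fibre letter at `t₀` and the base pole at `y₀`**: the blow-up
hypothesis applies once the cell is rewritten on its two explicit rows. -/
theorem IsNest.good_pinch_blow (hB : BlowUp) (hN : IsNest s M i j A Bd T p a) (y₀ t₀ ε₁ ε : ℚ)
    (hε₁ : ε₁ = 1 ∨ ε₁ = -1) (hε : 0 < ε) (hA0 : A.1 (Fin.last 0) * y₀ + A.2 = t₀)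
    (hB0 : Bd.1 (Fin.last 0) * y₀ + Bd.2 = t₀) (hα : 0 < ε₁ * A.1 (Fin.last 0))
    (hαβ : ε₁ * A.1 (Fin.last 0) < ε₁ * Bd.1 (Fin.last 0)) (hp : T.ℓ₂.2 = y₀)
    (hat : ∃ l₀ : Fin 2, ∀ l c, l ≠ l₀ → a l = some c → c.2 = t₀)
    (hcellI : ∀ y : ℝ, y ∈ cell M ↔ (0 < (ε₁ : ℝ) * (y - y₀) ∧ (ε₁ : ℝ) * (y - y₀) < ε)) :
    Good 2 (KZ.of s) := by
  have hdom : s.domain = gDom 0 2 2 ![RebaseZero.mk ε₁ (-(ε₁ * y₀)), RebaseZero.mk (-ε₁) (ε₁ * y₀ + ε)]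
      (nlo i A) (nhi j Bd) := by
    rw [hN.dom]
    ext z
    show (_ ∧ _) ↔ (_ ∧ _)
    exact and_congr_left' ((rows_iff M z).trans (((hcellI _).trans (mem_cell_two y₀ ε ε₁ _).symm).trans
      (rows_iff _ z).symm))
  exact hB T.m s T.L T.e p T.ℓ₁ T.ℓ₂ T.n₁ T.n₂ a (nlo i A) (nhi j Bd) i j A Bd y₀ t₀ ε ε₁ hN.ne (nlo_self i A)
    (nhi_of_ne hN.ne Bd) (nlo_of_ne hN.ne A) (nhi_self j Bd) hN.n1 hN.n2 hε hε₁ hp hA0 hB0 hα hαβ hN.a0 hat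
    hN.bdd hdom hN.int

end RebaseNest

/-- Registered support goal of this file (part of `rebaseSimpleZero_nestedCommon`): pinch above
with fibre letters at the vertex level and base pole away (`RebaseNest.IsNest.good_pinch_super`). -/
theorem rebaseSimpleZero_nestedPinchSuper (m' : ℕ) (s : KZ.IntegralRep (0 + 1 + 2)) (M : Fin m' → (Fin (0 + 1) → ℚ) × ℚ) (i j : Fin 2) (A Bd : (Fin (0 + 1) → ℚ) × ℚ) (T : RebaseZero.BData) (p : MvPolynomial (Fin 0) ℚ) (a : Fin 2 → Option ((Fin (0 + 1) → ℚ) × ℚ)) (hN : RebaseNest.IsNest s M i j A Bd T p a) (y₀ t₀ ε₁ ε Tc η d : ℚ) (hε₁ : ε₁ = 1 ∨ ε₁ = -1) (hA0 : A.1 (Fin.last 0) * y₀ + A.2 = t₀) (hB0 : Bd.1 (Fin.last 0) * y₀ + Bd.2 = t₀) (hα : 0 < ε₁ * A.1 (Fin.last 0)) (hαβ : ε₁ * A.1 (Fin.last 0) ≤ ε₁ * Bd.1 (Fin.last 0)) (hcell : ∀ y ∈ RebaseZero.cell M, 0 < (ε₁ : ℝ) * (y - y₀) ∧ (ε₁ :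 ℝ) * (y - y₀) < ε) (hTc : t₀ + ε₁ * Bd.1 (Fin.last 0) * ε ≤ Tc) (hη : 0 < η) (hfar : ∀ l c, a l = some c → c.2 ≠ t₀ → ∀ t : ℝ, (t₀ : ℝ) < t → t < Tc → (η : ℝ) ≤ |t - c.2|) (hd : 0 < d) (hpole : ∀ y ∈ RebaseZero.cell M, (d : ℝ) ≤ |y - T.ℓ₂.2|) : RebaseZero.Good 2 (KZ.of s) :=
  hN.good_pinch_super y₀ t₀ ε₁ ε Tc η d hε₁ hA0 hB0 hα hαβ hcell hTc hη hfar hd hpole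

end Summit.KontsevichZagierPeriods.ArrangementNormalForm.JanusBands
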